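import Summits.AtomisticToContinuum.HydrodynamicLimit.Theorems.InfluenceLocality.Negative.IgnitionTemplates
import Summits.AtomisticToContinuum.HydrodynamicLimit.Theorems.InfluenceLocality.Negative.PhaseTracking
import HarnessLib

/-!
# `InfluenceLocality` (stmt-AtomisticToContinuum-13916) — bridge: track-valid script ⇒ `ignition` field

Line `ignition-cascade-refutation` (lead c3, 2026-08-17), Phase 2 (construction of `IgnitionTemplates`,
Negative/IgnitionTemplates.lean). The design-independent bridge from the abstract robust-tracking theorem
`stub_phaseTracking` (Negative/PhaseTracking.lean, p134191) to the `ignition` field of `IsIgnitionTemplate`: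
if a `TrackValid` phase script for diameter `hsDiameter σ N` and horizon `T ℓ_N` contains every state of the
tolerance box `templateBox p w rx rv` in its phases `0` at time `0`, and the phase-`0` deadline of every particle of
`K` is at most `T ℓ_N`, then every hard-sphere trajectory issued from the box changes the velocity of every particle
of `K` before `T ℓ_N`. Helper toward the registered stub `stub_ignitionTemplates_core`; asserts no Theses decl.
-/

namespace Summit.AtomisticToContinuum.HydrodynamicLimit.Theorems.InfluenceLocality.Negative

open MeasureTheory Set
open scoped InnerProductSpace
open Literature.Analysis.FluidPDE Literature.MathematicalPhysics.KineticTheory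
open Literature.Analysis.FunctionSpaces
open Summit.AtomisticToContinuum.HydrodynamicLimit.Theses.AntiMazurCoboundaries (InfluenceLocality)

noncomputable section

/-- BRIDGE (proved, design-independent): if a track-valid phase script for diameter `hsDiameter σ N` and horizon
`T ℓ_N` has every state of the tolerance box in its phases `0` at time `0`, and the phase-`0` deadline of every
particle of `K` is at most `T ℓ_N`, then the `ignition` field of `IsIgnitionTemplate` holds: every hard-sphere
trajectory issued from the box changes the velocity of every particle of `K` before `T ℓ_N`
(by `stub_phaseTracking`, p134191). -/
theorem ignition_of_script {σ T : ℝ} {N : ℕ} {p : Fin (N + 1) → T3} {w : Fin (N + 1) → V3}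
    {rx rv : Fin (N + 1) → ℝ} {K : Finset (Fin (N + 1))} (hε : 0 < hsDiameter σ N)
    (S : PhaseScript (N + 1)) (hS : S.TrackValid (hsDiameter σ N) (T * ell N))
    (h0 : ∀ z ∈ templateBox p w rx rv, ∀ i, ((0 : ℝ), (z i).1, (z i).2) ∈ S.phase i 0)
    (hK : ∀ i ∈ K, S.deadline i 0 ≤ T * ell N) :
    ∀ z ∈ templateBox p w rx rv, ∀ γ : ℝ → Config (N + 1) (Fin 3) T3,
      IsHardSphereTrajectory (Torus.geometry (Fin 3)) (hsDiameter σ N) (N + 1) γ → γ 0 = z →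
      ∀ i ∈ K, ∃ t ∈ Set.Icc (0 : ℝ) (T * ell N), (γ t i).2 ≠ (z i).2 := by
  intro z hz γ hγ hγ0 i hi
  have h0' : ∀ j, ((0 : ℝ), (γ 0 j).1, (γ 0 j).2) ∈ S.phase j 0 := by
    intro j
    rw [hγ0]
    exact h0 z hz j
  obtain ⟨t, ht, hne⟩ := stub_phaseTracking hε S hS hγ h0' i (hK i hi)
  refine ⟨t, ⟨ht.1, ht.2.trans (hK i hi)⟩, ?_⟩
  rw [hγ0] at hne
  exact hne

end

end Summit.AtomisticToContinuum.HydrodynamicLimit.Theorems.InfluenceLocality.Negative
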